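import Summits.QuantumFields.YangMills.Theorems.BalabanUVNodesN12MinimiserFamilyKnitRowThresholdUniform
import Literature.MathematicalPhysics.QuantumFieldTheory.Balaban1983to89.B15Prop1Thm1RowsOfExistsUnique
import HarnessLib

/-!
# BalabanUVNodes ∕ N12 — THE KNIT's (J0′) ROW FROM TWO CLOSED [15] LETTERS, FED ON THE NORMALISED SLICE: the εreg-uniform (J0′) junction at `𝐁_k(Z)` with its per-base-field rows
# (E) ∕ (T1@q₀) DISCHARGED by the lane's `B15Prop1Thm1RowsOfExistsUnique` ([15] Thm 1 read ONCE, instance-independently, over NODE 00's torus class) and NO per-base-field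
# hypothesis left — the datum letter becomes an antecedent of the conclusion, per base field, on a COMPACT slice (the repair side of the lane's LOCATED-GAUGE-ORBIT)
# ([Balaban1985Variational] (1) p.277, (2)–(7) p.278, Thm 1 (8) p.279, Sect. C (44)–(48) p.285, (81)–(83) p.290, Sect. G pp.305–307, (181) p.307, Prop. 9 (190) p.309;
# [Balaban1989LargeFieldI] (1.74) p.192, p.193 ll.14–20, Prop. 1 p.194; [Balaban1985RegularSpaces] (1.3)–(1.9) p.77; [Balaban1989LargeFieldII] p.357, (1.7)–(1.9) p.358,
# (1.12)–(1.13) p.359; [Balaban1988Convergent] (2.1)–(2.2) pp.254–255, (2.10)–(2.13) pp.256–257, (2.18) p.257; [Balaban1985Averaging] (9) p.18, Prop. 2 (52)–(54) p.26,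
# (122)–(126) p.36; [Balaban1987RG1] (0.4) p.253)

Cell `pub-ymgap` (HUMAN RULINGS D-0062 ∕ D-0149), seat `pub-ymgap-dag-n12-d` g25 (R134 N12 [B15] s2 = by-name knit at the record; census item E1 = the (J0′) row; count-neutral helper of K1⁹
`stmt-QuantumFields-27364`, `--kind proof --supports … --as helper`).  THEOREMS ONLY (0 `def`, 0 `instance`, 0 `sorry`); compositions BY NAME plus finite-dimensional continuity
bookkeeping.  Fifth leaf of the junction family `N12MinimiserFamilyKnitRow` (p707982) ∕ `…KnitRowTower` (p711030 + p721314) ∕ `…KnitRowThreshold` (p724291) ∕ `…KnitRowThresholdUniform`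
(p726412) — own leaf for the 400-line rule.

WHY (the lane's LOCATED-GAUGE-ORBIT, dag-n12-c g27, 2026-08-29).  The junctions of record ask their per-base-field rows for EVERY base field of the CLOSED guard `|V_k(∂p′) − 1| ≤ eR`
on `(Z ∩ Λᶜ)^{(k)}` — a gauge-INVARIANT set — while the rows that are not [15] Thm 1 (the gauge letter (δ), resp. U3's DATUM letter «`ext V_k` is `ρn`-flat on `𝒞`») are NOT gauge
invariant: a pure gauge `1^g` with `g = −1` at one `k`-site off the `Λ`-shell lies in the guard and violates them (`dist1 = 2`).  So a hypothesis «∀ V_k ∈ guard, rows» can never be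
discharged: those junctions are honest but VACUOUS AS CONSUMED.  Print (p. 194: «it is natural to consider it on orbits of this group») normalises the datum FIRST.

WHAT.  This file feeds this seat's general-`K` twin (C″) `N12MinimiserFamilyAtRecordBjTowerDatumLettersUniform.hMin_atRecord_Bj_of_printLetters_ofClassDatumLettersUniform` (over the
lane's U3 p725063: dag-n12-w3's (σ)_N residual gauge INSIDE) on the NORMALISED SLICE `K′ := {closed guard ≤ eR} ∩ {V_k | ∀ c ∈ 𝒞, dist1 ((ext V_k) c) ≤ ρn}` — COMPACT: the
configuration space `(bonds → SU(2))` is compact, the guard is closed (`isCompact_setOf_plaqLeOn`), and the datum slice is closed because `V_k ↦ (ext V_k)(c)` =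
`(extend (pts k Λ) (shellGauge V_k lo hi) V_k)(c)` is CONTINUOUS (§0: parallel transports along the fixed shell words of p. 193, finitely many products ∕ inverses in `SU(2)`, case splits
on sites and bonds only).  On `K′` every per-base-field row of (C″) is a THEOREM: (E) and (T1@q₀) by the lane's `thm1Rows_atZ_of_thm1TorusClass_existsUnique` (ι := Unit, strict guard
`< 2eR` from `≤ eR`) from the two CLOSED instance-independent [15] letters `h15T` ((8)) ∕ `h15EUT` (existence ∕ uniqueness modulo tower-central gauges); the datum's scale-`k` plaquette
regularity on `Z` from the guard and the p. 193 extension (`dist1_plaqHol_extend_shellGauge_le`, as in the junctions of record); the datum letter by membership.  RESULT (E1, knit side):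

  ★ `exists_R_hMinRow_of_thm1Letters_onDatumSlice`: after the per-height letters, (σ)_N's numerics, dag-n12-w6's region geometry `𝒞 N hGN hN1 hM₁ hGmem` and the two [15] letters —
  all displayed ONCE per (instance, height) — there is `δ₀ > 0` such that for every fine window + geometry rows (12Q v11's `hn hN5 hlohi hbox hZ hcE`), guard radius `eR` within the budget,
  extension `ext`, bound `𝓐₀ > 1`, class tolerance `εr` (five rows) tied to `eR` by [15]'s comparability rows `(c_E+1)·2eR ≤ a₁`, `B₃(c_E+1)·2eR ≤ εr < ε₀ ≤ a₀`, and datum bond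
  tolerance `ρn ≥ 0` with U3's «`T(ρn, εr) ≤ δ₀`» row, WITH NO PER-BASE-FIELD HYPOTHESIS:
  `∃ R > 0, ∀ V_k, PlaqSmallOn (plaqsInside (pts k (Z ∩ Λᶜ))) eR V_k → (∀ c ∈ 𝒞, dist1 ((ext V_k) c) ≤ ρn) → <12Q ∕ 12X-W v11 hMin ∀-body at V_k, radius R, bound 𝓐₀, class at εr>`.

The remaining antecedent is print's normalisation of the datum; it is removed downstream, NOT here, by GAUGE COVARIANCE of the `hMin` body along the `k`-gauge orbit (the lane's INTENT-2
`B15Prop1MinimiserFamilyGaugeCovariance.hMinBody_gaugeAct_atRecord`: radius `R∕6`, bound `4𝓐₀`) composed with dag-n12-w6's normalising gauge (`B15Prop1DatumGaugeNormalisation`).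

HONEST FRAMING ∕ LOCATED.  One composition by name + continuity bookkeeping; [15] Thm 1 ((8), existence, uniqueness) stays DISPLAYED as the two closed letters `h15T`∕`h15EUT` (their
inhabitant is K0⁷ ∕ NODE 00's house, not in the tree); the normalisation antecedent is displayed per base field inside the conclusion; `δ₀`, `R`, `ρ″`, `εH`, `B` = EXISTENCE constants
per (instance, height) (census U4: print's volume-uniform (46)∕(83) and `k`-uniformity NOT claimed); nothing of Bałaban's estimates asserted; N12 NOT discharged; K1⁹ NOT closed; counts
unmoved; one finite 𝕋⁴ programme at fixed `ε = L^{-K}` — R4 closes only the conditional rung `BalabanLadder.UV`; no summit statement is proved here and NOT the Yang–Mills mass gap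
(Clay); nothing continuum ∕ ℝ⁴ ∕ OS.
-/

noncomputable section

namespace Summit.QuantumFields.YangMills.BalabanUVNodes.N12MinimiserFamilyKnitRowThm1Letters

open scoped BigOperators Matrix.Norms.L2Operator Topology
open Literature.MathematicalPhysics.QuantumFieldTheory.Balaban1983to89
open T4Continuum
open B15DeterminingSets GaugeField
open ExpMeanLog (expMeanLogSU deltaSU)
open T4AdjointCovarianceUnitary (lieSU)
open Node00
open B15Prop1AnalyticExtClause (cplxVec)
open B15Prop1ChartCalculusSU2 (E3)
open T4CubeChartGnomonic (SU2)
open B14.Eq213DetSet (Bj maxDomT)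
open B14.Eq213MaximalDomains (side)
open B14.Eq22Determines (IsBlockUnion)
open B14.Eq216Concrete (feeds)
open B5Eq118OneStroke (iterBlockOf)
open B15Eq112TorusCover (lift)
open T4AxialGaugeSmallField (boxPlaqs castSite)
open B15Prop1Carrier (plaqsInside)
open Literature.MathematicalPhysics.QuantumFieldTheory.BalabanImbrieJaffe1984to88.BIJ85Eq453GaugeField (qsstarGIter0)
open B15ShellGauge193 (shellGauge)
open B15Extension193 (extend)
open B16Sect1Backgrounds (toMS expMul)
open B15Prop1ChartSU2 (su2Chart)
open Metric (ball)
open B15Prop1ClosedGuardUniformRadius (isCompact_setOf_plaqLeOn plaqLeOn_of_plaqSmallOn)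
open B15ShellGauge193Local (dist1_plaqHol_extend_shellGauge_le)
open B15Extension193 (cutoff primed Touches)
open B12ContinuousTransportInvarianceOn (continuous_dist1_SU)
open Summit.QuantumFields.YangMills.BalabanUVNodes.N12MinimiserFamilyAtRecordBjTowerDatumLettersUniform (hMin_atRecord_Bj_of_printLetters_ofClassDatumLettersUniform)
open B15Prop1Thm1RowsOfExistsUnique (thm1Rows_atZ_of_thm1TorusClass_existsUnique)

variable {F : T4Family} {k : ℕ}



/-! ## §0  Bookkeeping: the junction's box row from the knit's; CONTINUITY of the p. 193 extension in the base field; the normalised slice is COMPACT -/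

/-- The junction's box row `hi − lo + 3 < sitesPerDir k` (what [IV] p. 193's extension lemma `dist1_plaqHol_extend_shellGauge_le` reads) follows from the knit's own row
`(hi − lo + 1)⁺ + 5 < sitesPerDir k` (12Q v11's `hN5`) on a non-degenerate window `lo ≤ hi`. [cite: Balaban1989LargeFieldI, p.193 L14–20 (bookkeeping)] -/
theorem boxRow3_of_boxRow5 {d : ℕ} {s : ℤ} {lo hi : Fin d → ℤ} (hlohi : lo ≤ hi) (hN5 : ∀ κ, ((hi κ - lo κ + 1).toNat : ℤ) + 5 < s) :
    ∀ κ, hi κ - lo κ + 3 < s := fun κ => by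
  have h5 := hN5 κ
  have hle : lo κ ≤ hi κ := hlohi κ
  have h1 : ((hi κ - lo κ + 1).toNat : ℤ) = hi κ - lo κ + 1 := Int.toNat_of_nonneg (by linarith)
  linarith

section Continuity

variable {P : Params} {j : ℕ}

/-- Parallel transport `V(Γ)` along a FIXED `ℤᵈ` word ([Balaban1985Averaging] (9)) is continuous in the configuration (finitely many products ∕ inverses in `SU(2)`).
[cite: Balaban1985Averaging, (9) p.18 (bookkeeping)] -/
theorem continuous_hol_pull (x : Fin P.d → ℤ) (w : List (B7Prop1Explicit.Letter P.d)) :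
    Continuous fun V : GaugeField P j SU2 => B7Prop1Explicit.hol (T4AxialGaugeSmallField.pull V) x w := by
  induction w generalizing x with
  | nil => exact continuous_const
  | cons l w ih =>
    have hstep : Continuous fun V : GaugeField P j SU2 => B7Prop1Explicit.stepHol (T4AxialGaugeSmallField.pull V) x l := by
      unfold B7Prop1Explicit.stepHol
      by_cases hl : l.2 = true
      · simp only [hl, if_true, T4AxialGaugeSmallField.pull_apply]
        exact continuous_apply _
      · simp only [hl, T4AxialGaugeSmallField.pull_apply]
        exact (continuous_apply _).inv
    exact hstep.mul (ih _)

/-- The shell gauge of [IV] p. 193 (the generalized axial gauge function `g(y) = V(Γ_y)`, `1` off the big box) is continuous in the configuration at every site.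
[cite: Balaban1989LargeFieldI, p.193 L14–20 (bookkeeping)] -/
theorem continuous_shellGauge_apply (lo hi : Fin P.d → ℤ) (s : Site P j) : Continuous fun V : GaugeField P j SU2 => shellGauge V lo hi s := by
  unfold shellGauge
  by_cases h : ∃ x : Fin P.d → ℤ, lo - 1 ≤ x ∧ x ≤ hi + 1 ∧ (castSite x : Site P j) = s
  · simp only [dif_pos h]
    unfold B15ShellGauge193.shellFn
    exact continuous_hol_pull _ _
  · simp only [dif_neg h]
    exact continuous_const

/-- The cut-off shell gauge (`1` on `Λ`) is continuous in the configuration at every site. [cite: Balaban1989LargeFieldI, p.193 L14–20 (bookkeeping)] -/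
theorem continuous_cutoff_shellGauge_apply (Λ : Set (Site P j)) (lo hi : Fin P.d → ℤ) (y : Site P j) :
    Continuous fun V : GaugeField P j SU2 => cutoff Λ (shellGauge V lo hi) y := by
  unfold cutoff
  by_cases hy : y ∈ Λ
  · simp only [if_pos hy]
    exact continuous_const
  · simp only [if_neg hy]
    exact continuous_shellGauge_apply lo hi y

/-- ★ **THE p. 193 EXTENSION `Ṽ_k = ext V_k` IS CONTINUOUS IN THE BASE FIELD, BOND BY BOND** (`extend Λ (shellGauge V lo hi) V`: case splits on sites ∕ bonds only, shell transports,
products and inverses in `SU(2)`). [cite: Balaban1989LargeFieldI, p.193 L14–20 (bookkeeping)] -/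
theorem continuous_extend_shellGauge_apply (Λ : Set (Site P j)) (lo hi : Fin P.d → ℤ) (c : PBond P j) :
    Continuous fun V : GaugeField P j SU2 => extend Λ (shellGauge V lo hi) V c := by
  have hcut := continuous_cutoff_shellGauge_apply (P := P) (j := j) Λ lo hi
  have hpr : Continuous fun V : GaugeField P j SU2 => primed Λ (shellGauge V lo hi) V c := by
    unfold primed
    by_cases ht : Touches Λ c
    · simp only [if_pos ht]
      exact continuous_const
    · simp only [if_neg ht]
      show Continuous fun V : GaugeField P j SU2 => cutoff Λ (shellGauge V lo hi) c.src * V c * (cutoff Λ (shellGauge V lo hi) c.tgt)⁻¹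
      exact ((hcut _).mul (continuous_apply _)).mul (hcut _).inv
  show Continuous fun V : GaugeField P j SU2 =>
    (cutoff Λ (shellGauge V lo hi) c.src)⁻¹ * primed Λ (shellGauge V lo hi) V c * ((cutoff Λ (shellGauge V lo hi) c.tgt)⁻¹)⁻¹
  exact ((hcut _).inv.mul hpr).mul (hcut _).inv.inv

/-- The DATUM SLICE `{V_k | ∀ c ∈ 𝒞, dist1 ((ext V_k) c) ≤ ρn}` of an extension of record `ext = extend Λ (shellGauge · lo hi)` is CLOSED (non-strict inequalities between continuous
functions). [cite: Balaban1989LargeFieldI, p.193 L14–20, Prop. 1 p.194 (bookkeeping)] -/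
theorem isClosed_datumSlice (Λ : Set (Site P j)) (lo hi : Fin P.d → ℤ) (ext : GaugeField P j SU2 → GaugeField P j SU2) (hext : ∀ W, ext W = extend Λ (shellGauge W lo hi) W)
    (𝒞 : Set (PBond P j)) (ρn : ℝ) : IsClosed {V : GaugeField P j SU2 | ∀ c ∈ 𝒞, dist1 ((ext V) c) ≤ ρn} := by
  have h : {V : GaugeField P j SU2 | ∀ c ∈ 𝒞, dist1 ((ext V) c) ≤ ρn} = ⋂ c ∈ 𝒞, {V : GaugeField P j SU2 | dist1 ((ext V) c) ≤ ρn} := by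
    ext V; simp only [Set.mem_setOf_eq, Set.mem_iInter]
  rw [h]
  refine isClosed_biInter fun c _ => isClosed_le ?_ continuous_const
  have he : (fun V : GaugeField P j SU2 => (ext V) c) = fun V => extend Λ (shellGauge V lo hi) V c := funext fun V => by rw [hext]
  exact (continuous_dist1_SU (N := 2)).comp (he ▸ continuous_extend_shellGauge_apply Λ lo hi c)

/-- ★ **THE NORMALISED SLICE IS COMPACT**: the closed small-field guard (`isCompact_setOf_plaqLeOn`: `SU(2)` compact, guard closed) cut by the closed datum slice.
[cite: Balaban1989LargeFieldI, (1.74) p.192, p.193 L14–20, Prop. 1 p.194; Balaban1985Variational, (7) p.278] -/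
theorem isCompact_guard_inter_datumSlice (G : Set (Plaq P j)) (eR : ℝ) (Λ : Set (Site P j)) (lo hi : Fin P.d → ℤ) (ext : GaugeField P j SU2 → GaugeField P j SU2)
    (hext : ∀ W, ext W = extend Λ (shellGauge W lo hi) W) (𝒞 : Set (PBond P j)) (ρn : ℝ) :
    IsCompact {V : GaugeField P j SU2 | (∀ p ∈ G, dist1 (GaugeField.plaqHol V p) ≤ eR) ∧ ∀ c ∈ 𝒞, dist1 ((ext V) c) ≤ ρn} :=
  (isCompact_setOf_plaqLeOn G eR).inter_right (isClosed_datumSlice Λ lo hi ext hext 𝒞 ρn)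

end Continuity


/-! ## §1  The knit's (J0′) row from `h15T` + `h15EUT`, fed on the normalised slice — NO per-base-field hypothesis -/

/-- ★★★★ **THE KNIT's (J0′) ROW SHAPE, εreg-UNIFORM, FROM TWO CLOSED [15] LETTERS, WITH NO PER-BASE-FIELD HYPOTHESIS** — this seat's general-`K` twin (C″)
`hMin_atRecord_Bj_of_printLetters_ofClassDatumLettersUniform` (over the lane's U3: (σ)_N inside, numerics `hkc`∕`hc`∕`hMrad`, dag-n12-w6's region geometry `𝒞 N hGN hN1 hM₁ hGmem`, datum
bond tolerance `ρn` with U3's «`T(ρn, εr) ≤ δ₀`» row) at the COMPACT normalised slice `K′ := {closed guard ≤ eR on (Z ∩ Λᶜ)^{(k)}} ∩ {∀ c ∈ 𝒞, dist1 ((ext V_k) c) ≤ ρn}` (§0), datum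
tolerance `δ := 2(c_E+1)eR`, every per-base-field row of (C″) a theorem on `K′`: (E) and (T1@q₀) by the lane's `thm1Rows_atZ_of_thm1TorusClass_existsUnique` (`ι := Unit`, `ε := 2eR`)
from the two closed instance-independent [15] letters `h15T`∕`h15EUT`, the datum's plaquette regularity from the guard through `dist1_plaqHol_extend_shellGauge_le`, the datum letter by
membership.  Displayed ONCE: per-height letters, (σ)_N numerics, region geometry, `h15T`, `h15EUT`; after `δ₀`: window + geometry rows (`hN5` form), budget, `ext`, `𝓐₀`, the five `εr`
rows, [15]'s comparability rows at `ε := 2eR`, `ρn ≥ 0` + the «T ≤ δ₀» row.  Conclusion: `∃ R > 0, ∀ V_k, strict guard → (∀ c ∈ 𝒞, dist1 ((ext V_k) c) ≤ ρn) → <12Q ∕ 12X-W v11 hMin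
∀-body at V_k (class at εr)>` — the normalisation antecedent is per base field INSIDE the conclusion (removed downstream by gauge covariance, the lane's INTENT-2), not a ∀-hypothesis.
[cite: Balaban1985Variational, (2)–(7) p.278, Thm 1 (8) p.279, Sect. C (44)–(48) p.285, (81)–(83) p.290, Sect. G pp.305–307, (181) p.307, Prop. 9 (190) p.309; Balaban1989LargeFieldI, (1.74) p.192, p.193 L14–20, Prop. 1 p.194; Balaban1985RegularSpaces, (1.3)–(1.9) p.77; Balaban1989LargeFieldII, p.357, (1.7)–(1.9) p.358, (1.12)–(1.13) p.359; Balaban1988Convergent, (2.1)–(2.2) pp.254–255, (2.10)–(2.13) pp.256–257, (2.18) p.257; Balaban1985Averaging, (9) p.18, Prop. 2 (52)–(54) p.26, (122)–(126) p.36; Balaban1987RG1, (0.4) p.253] -/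
theorem exists_R_hMinRow_of_thm1Letters_onDatumSlice (ν : Node00.Stage7Numerics) (Kt : ℕ) (hd3 : 3 ≤ (F.P Kt).d) (Z : Set (Site (F.P Kt) 0))
    (hkK : k + 1 ≤ (F.P Kt).m + (F.P Kt).K) (hk1 : 1 ≤ k) (hdiv : side (F.P Kt).L ν.M₁ k ∣ (F.P Kt).sitesPerDir 0) (hfloor : ((F.P Kt).d + 14) * (F.P Kt).L ≤ ν.M₁) (hZblk : IsBlockUnion k Z)
    -- the per-HEIGHT letters (EXISTENCE constants per (instance, height); dag-n12-w6's `N12HsurjOfClass.exists_hsurjLetters`)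
    {ρ'' : ℝ} (hsbU : ∀ W : GaugeField (F.P Kt) 0 SU2, ‖coeField W - 1‖ ≤ ρ'' → SmallBelow (Node00.avOfRecord F 2 Kt) k W) (hρ : 0 < ρ'')
    {εH B : ℝ}
    (hHB : ∀ (Wd : MSField (F.P Kt) SU2) (U₀ : GaugeField (F.P Kt) 0 SU2),
      AgreeOn (Bj ν.M₁ Z k) (avgFamily (avOfRecord F 2 Kt) U₀) Wd →
      (∀ i' : Fin (constrCard (Bj ν.M₁ Z k) k), ∃ U' : GaugeField (F.P Kt) 0 SU2,
        (∀ b ∈ feeds (((constrEnum (Bj ν.M₁ Z k) k).symm i').1 : ℕ) ((constrEnum (Bj ν.M₁ Z k) k).symm i').2.1, U' b = U₀ b) ∧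
          SmallBelow (avOfRecord F 2 Kt) k U') →
      (∀ (j : ℕ), 1 ≤ j → j ≤ k → ∀ y : Site (F.P Kt) j, embIter j y ∈ maxDomT ν.M₁ Z j → ∃ U' : GaugeField (F.P Kt) 0 SU2,
        (∀ c : PBond (F.P Kt) j, (c.src = y ∨ c.tgt = y) → ∀ b₀ : PBond (F.P Kt) 0,
          (iterBlockOf j b₀.src = c.src ∨ iterBlockOf j b₀.src = c.tgt) → (iterBlockOf j b₀.tgt = c.src ∨ iterBlockOf j b₀.tgt = c.tgt) → U' b₀ = U₀ b₀) ∧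
        SmallBelow (avOfRecord F 2 Kt) k U') →
      (∀ (j : ℕ), 1 ≤ j → j ≤ k → ∀ y : Site (F.P Kt) j, embIter j y ∈ maxDomT ν.M₁ Z j →
        PlaqSmallOn (boxPlaqs (fun κ => lift (F.P Kt) (embIter j y) κ - ((((F.P Kt).L ^ j : ℕ) : ℤ) + ((((F.P Kt).L ^ j - 1) / 2 : ℕ) : ℤ)))
          (fun κ => lift (F.P Kt) (embIter j y) κ + ((((F.P Kt).L ^ j : ℕ) : ℤ) + ((((F.P Kt).L ^ j - 1) / 2 : ℕ) : ℤ))) : Set (Plaq (F.P Kt) 0)) εH U₀) →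
      ∃ H : (Fin (constrCard (Bj ν.M₁ Z k) k) → lieSU (Fin 2)) → PBond (F.P Kt) 0 → lieSU (Fin 2),
        (∀ v, fderiv ℝ (msChart F 2 Kt k (Bj ν.M₁ Z k) Wd U₀) 0 (H v) = v) ∧ ∀ v, Real.sqrt (∑ b, ‖H v b‖ ^ 2) ≤ B * ‖v‖) (hB0 : 0 ≤ B)
    -- (σ)_N OF RECORD (dag-n12-w3's `N12GaugeLetterLocExplicit.exists_gaugeLetterLoc_atRecord_explicit`), instance-level NUMERICS verbatim: a level guard `k + c ≤ m + K` with
    -- `4d + m′ + 3 < 2·L^c`, and `M₁ ≥ (4d + m′)·L² + 2d·L + 12`, `m′ = 3·(d·((L−1)∕2)) + 5`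
    {c : ℕ} (hkc : k + c ≤ (F.P Kt).m + (F.P Kt).K) (hc : 4 * (F.P Kt).d + (3 * ((F.P Kt).d * (((F.P Kt).L - 1) / 2)) + 5) + 3 < 2 * (F.P Kt).L ^ c)
    (hMrad : (4 * (F.P Kt).d + (3 * ((F.P Kt).d * (((F.P Kt).L - 1) / 2)) + 5)) * (F.P Kt).L ^ 2 + 2 * (F.P Kt).d * (F.P Kt).L + 12 ≤ ν.M₁)
    -- region geometry (dag-n12-w6's letters, verbatim) for a set `𝒞` of scale-`k` bonds and a fine bond set `N`
    (𝒞 : Set (PBond (F.P Kt) k))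
    (N : Set (PBond (F.P Kt) 0))
    (hGN : ∀ b ∈ N, (b.src ∉ maxDomT ν.M₁ Z 1 ∨ b.tgt ∉ maxDomT ν.M₁ Z 1) → B14.Eq22Determines.blockIter k b.tgt ≠ B14.Eq22Determines.blockIter k b.src →
      (⟨B14.Eq22Determines.blockIter k b.src, b.dir⟩ : PBond (F.P Kt) k) ∈ 𝒞)
    (hN1 : ∀ p : Plaq (F.P Kt) 0, ((⟨p.src, p.μ⟩ : PBond (F.P Kt) 0) ∈ {b : PBond (F.P Kt) 0 | b.src ∈ maxDomT ν.M₁ Z 1} ∨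
        (⟨p.src.shift p.μ, p.ν⟩ : PBond (F.P Kt) 0) ∈ {b : PBond (F.P Kt) 0 | b.src ∈ maxDomT ν.M₁ Z 1} ∨
        (⟨p.src.shift p.ν, p.μ⟩ : PBond (F.P Kt) 0) ∈ {b : PBond (F.P Kt) 0 | b.src ∈ maxDomT ν.M₁ Z 1} ∨
        (⟨p.src, p.ν⟩ : PBond (F.P Kt) 0) ∈ {b : PBond (F.P Kt) 0 | b.src ∈ maxDomT ν.M₁ Z 1}) →
      (⟨p.src, p.μ⟩ : PBond (F.P Kt) 0) ∈ N ∧ (⟨p.src.shift p.μ, p.ν⟩ : PBond (F.P Kt) 0) ∈ N ∧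
        (⟨p.src.shift p.ν, p.μ⟩ : PBond (F.P Kt) 0) ∈ N ∧ (⟨p.src, p.ν⟩ : PBond (F.P Kt) 0) ∈ N)
    -- the family's support numerics: `M₁ ≥ ((d+4)L + 6)·L²`
    (hM₁ : (((F.P Kt).d + 4) * (F.P Kt).L + 6) * (F.P Kt).L ^ 2 ≤ ν.M₁)
    -- GEOMETRY: the `k`-shadows of the face-crossing members of `𝐁_k(Z)` lie in `𝒞`
    (hGmem : ∀ i ≤ k, ∀ c ∈ bondsOf ((Bj ν.M₁ Z k : DetSet (F.P Kt)) i), B14.Eq22Determines.blockIter k (embIter i c.tgt) ≠ B14.Eq22Determines.blockIter k (embIter i c.src) →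
      (⟨B14.Eq22Determines.blockIter k (embIter i c.src), c.dir⟩ : PBond (F.P Kt) k) ∈ 𝒞)
    -- THE TWO CLOSED, INSTANCE-INDEPENDENT [15] LETTERS over NODE 00's torus class (the lane's `h15T` ∕ `h15EUT`, VERBATIM)
    {B₃ a₀ a₁ : ℝ}
    (h15T : ∀ (k' : ℕ), k' ≤ (F.P Kt).m + (F.P Kt).K → side (F.P Kt).L ν.M₁ k' ∣ (F.P Kt).sitesPerDir 0 →
      ∀ (s : B14.Eq218Concrete.Seq (fun n : ℕ => Node00.unionsOfCubes (F.P Kt) (side (F.P Kt).L ν.M₁ n)) k'),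
      Node00.Sect2.SeqSeparated ν.M₁ s → 0 < ν.M₁ →
      ∀ (ε₀ : ℝ) (δ : ℕ → ℝ), (∀ j, j ≤ k' → 0 < δ j ∧ δ j ≤ a₁ ∧ B₃ * δ j ≤ ε₀) → (∀ j, j < k' → δ j ≤ 2 * δ (j + 1)) →
      (∀ j, j < k' → δ (j + 1) ≤ 2 * δ j) → ε₀ ≤ a₀ →
      ∀ W : MSField (F.P Kt) SU2,
        Node00.Sect2.DataSmall7PTop (Node00.avOfRecord F 2 Kt) s.Ω (Node00.suppDomOfRecord F ν Kt s.Ω) k' δ W →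
        ∀ U₀ : GaugeField (F.P Kt) 0 SU2, IsMinimizer (Node00.avOfRecord F 2 Kt)
            {U | (∀ j, j ≤ k' → PlaqSmallOn (Node00.Sect2.omegaPlaqsTop s.Ω (Node00.suppDomOfRecord F ν Kt s.Ω) j)
                (ε₀ * (F.P Kt).eta j ^ 2) U) ∧
              Node00.Sect2.CoDivClassOnTop s.Ω (Node00.suppDomOfRecord F ν Kt s.Ω) k' ε₀ U}
            (genSet s.Ω k') W U₀ →
          (∀ j, j ≤ k' → PlaqSmallOn (Node00.Sect2.omegaPlaqsTop s.Ω (Node00.suppDomOfRecord F ν Kt s.Ω) j)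
              (B₃ * δ j * (F.P Kt).eta j ^ 2) U₀) ∧
            ∀ j, j ≤ k' → Node00.Sect2.CoDivSmallOn (Node00.Sect2.omegaBondsTop s.Ω (Node00.suppDomOfRecord F ν Kt s.Ω) j)
              (B₃ * δ j * (F.P Kt).eta j ^ 3) U₀)
    (h15EUT : ∀ (k' : ℕ), k' ≤ (F.P Kt).m + (F.P Kt).K → side (F.P Kt).L ν.M₁ k' ∣ (F.P Kt).sitesPerDir 0 →
      ∀ (s : B14.Eq218Concrete.Seq (fun n : ℕ => Node00.unionsOfCubes (F.P Kt) (side (F.P Kt).L ν.M₁ n)) k'),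
      Node00.Sect2.SeqSeparated ν.M₁ s → 0 < ν.M₁ →
      ∀ (ε₀ : ℝ) (δ : ℕ → ℝ), (∀ j, j ≤ k' → 0 < δ j ∧ δ j ≤ a₁ ∧ B₃ * δ j ≤ ε₀) → (∀ j, j < k' → δ j ≤ 2 * δ (j + 1)) →
      (∀ j, j < k' → δ (j + 1) ≤ 2 * δ j) → ε₀ ≤ a₀ →
      ∀ W : MSField (F.P Kt) SU2,
        Node00.Sect2.DataSmall7PTop (Node00.avOfRecord F 2 Kt) s.Ω (Node00.suppDomOfRecord F ν Kt s.Ω) k' δ W →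
        (∃ U₀ : GaugeField (F.P Kt) 0 SU2, IsMinimizer (Node00.avOfRecord F 2 Kt)
            {U | (∀ j, j ≤ k' → PlaqSmallOn (Node00.Sect2.omegaPlaqsTop s.Ω (Node00.suppDomOfRecord F ν Kt s.Ω) j)
                (ε₀ * (F.P Kt).eta j ^ 2) U) ∧
              Node00.Sect2.CoDivClassOnTop s.Ω (Node00.suppDomOfRecord F ν Kt s.Ω) k' ε₀ U}
            (genSet s.Ω k') W U₀) ∧
        ∀ U₁ U₂ : GaugeField (F.P Kt) 0 SU2,
          IsMinimizer (Node00.avOfRecord F 2 Kt)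
            {U | (∀ j, j ≤ k' → PlaqSmallOn (Node00.Sect2.omegaPlaqsTop s.Ω (Node00.suppDomOfRecord F ν Kt s.Ω) j)
                (ε₀ * (F.P Kt).eta j ^ 2) U) ∧
              Node00.Sect2.CoDivClassOnTop s.Ω (Node00.suppDomOfRecord F ν Kt s.Ω) k' ε₀ U}
            (genSet s.Ω k') W U₁ →
          IsMinimizer (Node00.avOfRecord F 2 Kt)
            {U | (∀ j, j ≤ k' → PlaqSmallOn (Node00.Sect2.omegaPlaqsTop s.Ω (Node00.suppDomOfRecord F ν Kt s.Ω) j)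
                (ε₀ * (F.P Kt).eta j ^ 2) U) ∧
              Node00.Sect2.CoDivClassOnTop s.Ω (Node00.suppDomOfRecord F ν Kt s.Ω) k' ε₀ U}
            (genSet s.Ω k') W U₂ →
          ∃ u : GaugeTransf (F.P Kt) 0 SU2,
            (∀ j, j ≤ k' → ∀ b ∈ bondsOf (genSet s.Ω k' j), toMS u j b.src = toMS u j b.tgt ∧ ∀ g : SU2, toMS u j b.src * g = g * toMS u j b.src) ∧
              gaugeAct u U₁ = U₂) :
    ∃ δ₀ : ℝ, 0 < δ₀ ∧
    ∀ (Λ : Set (Site (F.P Kt) 0)) (lo hi : Fin (F.P Kt).d → ℤ) (eR : ℝ), 0 < eR →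
    ∀ (n : ℕ), (∀ κ, hi κ ≤ lo κ + n) → (∀ κ, ((hi κ - lo κ + 1).toNat : ℤ) + 5 < ((F.P Kt).sitesPerDir k : ℤ)) → lo ≤ hi →
      pts k Λ = (castSite '' Set.Icc lo hi : Set (Site (F.P Kt) k)) → (boxPlaqs (lo - 1) (hi + 1) : Set (Plaq (F.P Kt) k)) ⊆ plaqsInside (pts k Z) →
    ∀ {cE : ℝ}, 12 * ((F.P Kt).d : ℝ) * ((n : ℝ) + 2) ^ 2 ≤ cE → 6 * ((((F.P Kt).d - 1 : ℕ)) : ℝ) * (F.P Kt).L ^ k * (2 * ((cE + 1) * eR)) ≤ ρ'' →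
    ∀ (ext : GaugeField (F.P Kt) k SU2 → GaugeField (F.P Kt) k SU2), (∀ W, ext W = extend (pts k Λ) (shellGauge W lo hi) W) →
    ∀ {𝓐₀ : ℝ}, 1 < 𝓐₀ →
    ∀ (εr : ℝ), 0 < εr → 12 * ((((F.P Kt).d - 1 : ℕ)) : ℝ) * (F.P Kt).L * εr ≤ ρ'' → εr ≤ εH →
      (143 * (((((F.P Kt).d + 4 : ℕ) : ℝ)) ^ 2 / 4) ^ 2) * (2 * ((F.P Kt).L : ℝ) ^ 2 * εr) ≤ 1 / 3 →
      2 * (2 * ((F.P Kt).L : ℝ) ^ 2 * εr) ≤ 2 * deltaSU (Fin 2) / ((((F.P Kt).d + 4) * (F.P Kt).L : ℕ) : ℝ) ^ 2 →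
    -- [15]'s comparability rows at `ε := 2eR`
    ∀ {ε₀ : ℝ}, (cE + 1) * (2 * eR) ≤ a₁ → B₃ * ((cE + 1) * (2 * eR)) ≤ εr → εr < ε₀ → ε₀ ≤ a₀ →
    -- the datum bond tolerance `ρn` with U3's «`T(ρn, εr) ≤ δ₀`» row (VERBATIM)
    ∀ {ρn : ℝ}, 0 ≤ ρn →
    (max ρn ((((2 * (∑ i ∈ Finset.range (k + 1), ((F.P Kt).d * (((F.P Kt).L ^ i - 1) / 2) + 1)) + 1 +
                  (3 * ((F.P Kt).d * (((F.P Kt).L - 1) / 2)) + 5) * (F.P Kt).L ^ k : ℕ) : ℝ)) ^ 2 / 4 * (εr * (F.P Kt).eta 0 ^ 2) +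
                ((3 * ((F.P Kt).d * (((F.P Kt).L - 1) / 2)) + 5 : ℕ) : ℝ) * (6 * ((((((F.P Kt).d + 2) * (F.P Kt).L : ℕ) : ℝ) ^ 2 / 4) * (2 * (εr * (F.P Kt).L ^ 2))) * ∑ i ∈ Finset.range k, ((F.P Kt).L : ℝ) ^ i) + ((3 * ((F.P Kt).d * (((F.P Kt).L - 1) / 2)) + 5 : ℕ) : ℝ) * ρn) ≤ δ₀) →
    -- NO PER-BASE-FIELD HYPOTHESIS: the datum letter is an antecedent INSIDE the conclusion
    ∃ R : ℝ, 0 < R ∧ ∀ Vk : GaugeField (F.P Kt) k SU2, PlaqSmallOn (plaqsInside (pts k (Z ∩ Λᶜ))) eR Vk → (∀ c ∈ 𝒞, dist1 ((ext Vk) c) ≤ ρn) →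
      ∃ Ũ : VecField (F.P Kt) k (EuclideanSpace ℂ (Fin 3)) × VecField (F.P Kt) k (EuclideanSpace ℂ (Fin 3)) → PBond (F.P Kt) 0 → Matrix (Fin 2) (Fin 2) ℂ,
        (∀ b i j, DifferentiableOn ℂ (fun z => Ũ z b i j) (ball 0 R)) ∧
        (∀ z ∈ ball (0 : VecField (F.P Kt) k (EuclideanSpace ℂ (Fin 3)) × VecField (F.P Kt) k (EuclideanSpace ℂ (Fin 3))) R, ∀ b i j, ‖Ũ z b i j‖ ≤ 𝓐₀) ∧
        ∀ p B' : VecField (F.P Kt) k E3, ‖p‖ < R → ‖B'‖ < R → ∃ U' : GaugeField (F.P Kt) 0 SU2,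
          (∀ b, Ũ (cplxVec p, cplxVec B') b = ((U' b : SU2) : Matrix (Fin 2) (Fin 2) ℂ)) ∧
            IsMinimizer (Node00.avOfRecord F 2 Kt) (Node00.regMSCoPOfRecord F 2 {ν with εreg := εr} Kt k (maxDomT ν.M₁ Z)) (Bj ν.M₁ Z k)
              (avgFamily (Node00.avOfRecord F 2 Kt) (qsstarGIter0 k (expMul su2Chart B' (ext (expMul su2Chart p Vk))))) U' := by
  obtain ⟨δ₀, hδ₀, h⟩ := hMin_atRecord_Bj_of_printLetters_ofClassDatumLettersUniform ν Kt hd3 Z hkK hk1 hdiv hfloor hZblk hsbU hρ hHB hB0 hkc hc hMrad 𝒞 N hGN hN1 hM₁ hGmem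
  refine ⟨δ₀, hδ₀, ?_⟩
  intro Λ lo hi eR heR n hn hN5 hlohi hbox hZ cE hcE hδρ ext hext 𝓐₀ h𝓐₀ εr hεr hερ hεH hα3 hα2 ε₀ hεa₁ hB₃ε hεr0 hε₀ ρn hρn hT
  have hN3 := boxRow3_of_boxRow5 hlohi hN5
  have hcE0 : 0 ≤ cE := le_trans (by positivity) hcE
  have hδ : 0 < 2 * ((cE + 1) * eR) := by positivity
  have hM2 : 2 ≤ ν.M₁ := by
    have hL := (F.P Kt).L_pos
    nlinarith [hfloor, hd3]
  have H15 := thm1Rows_atZ_of_thm1TorusClass_existsUnique ν Kt hd3 (ι := Unit) (fun _ => Z) (fun _ => Λ) (fun _ => k) (fun _ => hk1)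
    (fun _ => (by omega : k ≤ (F.P Kt).m + (F.P Kt).K)) (fun _ => lo) (fun _ => hi) (fun _ => n) (fun _ => hn) (fun _ => hbox) (fun _ => hZ) (fun _ => hN5)
    (fun _ => ext) (fun _ => hext) (fun _ => hlohi) (fun _ => hZblk) hM2 (fun _ => hdiv) hcE0 (fun _ => hcE) h15T h15EUT
  -- (C″) on the COMPACT normalised slice `K′ := closed guard ∩ datum slice`
  have hK := isCompact_guard_inter_datumSlice (plaqsInside (pts k (Z ∩ Λᶜ))) eR (pts k Λ) lo hi ext hext 𝒞 ρn
  obtain ⟨R, hR, h'⟩ := h (pts k Λ) lo hi hδ hδρ ext hext hK h𝓐₀ εr hεr hερ hεH hα3 hα2 hρn hT fun Vk hVk => by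
      obtain ⟨hVk, hD⟩ := hVk
      -- the closed guard `≤ eR` gives the strict guard `< 2eR`: [15]'s rows (E), (T1@q₀) from the two letters; the p. 193 extension is `12d(n+2)²·2eR`-regular on `Z^{(k)}`
      have h2 : PlaqSmallOn (plaqsInside (pts k (Z ∩ Λᶜ))) (2 * eR) Vk := fun q hq => (hVk q hq).trans_lt (by linarith)
      obtain ⟨⟨U₀, hmin⟩, hT1⟩ := H15 () εr ε₀ (2 * eR) Vk (by positivity) hεa₁ hB₃ε hεr0 hε₀ h2
      refine ⟨U₀, hmin, fun p hp => ?_, hD, hT1 U₀ hmin⟩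
      have hreg := (dist1_plaqHol_extend_shellGauge_le (G := SU2) hd3 hlohi hn hN3 hbox hZ (by positivity) h2).1 p hp
      rw [hext]
      refine hreg.trans_lt ?_
      have h1 : 12 * ((F.P Kt).d : ℝ) * ((n : ℝ) + 2) ^ 2 * (2 * eR) ≤ cE * (2 * eR) := mul_le_mul_of_nonneg_right hcE (by positivity)
      have h3 : cE * (2 * eR) + 2 * eR = 2 * ((cE + 1) * eR) := by ring
      linarith
  exact ⟨R, hR, fun Vk hVk hD => h' Vk ⟨plaqLeOn_of_plaqSmallOn hVk, hD⟩⟩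

end Summit.QuantumFields.YangMills.BalabanUVNodes.N12MinimiserFamilyKnitRowThm1Letters

end
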